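import Mathlib
import HarnessLib
import Summits.NavierStokesRegularity.NavierStokesRegularity.Theorems.LocalPressureProfileDoorPressureWindowToSlab
import Summits.NavierStokesRegularity.NavierStokesRegularity.Theorems.BernoulliDecelerationHeadMaxPointLemma

/-!
# Route LocalLevelHeadDoor · crux `LevelHeadProfileRigidity` (stmt-NavierStokesRegularity-28095) · LINE g6-2
# «pointwise clock» — STUB 1 `stub_headMonotone` (the LOAD-BEARING stub)

Seat ns-sz-p1 g5 (keyed by director-ns DIRECTOR-NS #237 (2)), `--supports stmt-NavierStokesRegularity-28095 --as helper`.
Registered skeleton of record: planner ns-idea-6 g6, `LevelHeadProfileRigidity_birth.lean` (sha12 `4684503e85f1`);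
this file proves its stub `StubHeadMonotone` VERBATIM (binders restated — a Theorems file cannot import the
planner's HOME skeleton):

  a door-class profile `v` on `(−∞,0) × ℝ³` (Type-I in time, space–time Type-I decay, continuous on the open slab,
  unit-viscosity Oseen–Duhamel identity, divergence-free slices) whose Bernoulli head `Q[v(t)] + ½|v(t)|²`
  vanishes identically on every slice has POINTWISE NON-INCREASING SPEED: `‖v(t₁,x)‖ ≤ ‖v(t₀,x)‖` for
  `t₀ < t₁ < 0`.

PROOF (all inputs are theorems of the tree).  `(v, Q[v])` is a classical Navier–Stokes solution on the open
slab (`isClassicalNSSolutionOn_rieszPressure_of_class`).  Fix `x` and `t₀ < 0`; the time-shift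
`s ↦ (v(t₀+s), Q[v(t₀+s)])` is classical on `[0, −t₀)` (`IsClassicalNSSolutionOn.comp_add_right` + `.mono`).  The head
being identically zero, EVERY point is a local maximum of the head, so the PROVED fixed-time max-point lemma
`bernoulliDeceleration_headMaxPointLemma_proof` (item 3036: `∂ₜ|u|² ≤ −2ν|curl u|²` at a head maximum) gives
`derivWithin (s ↦ ‖v(t₀+s,x)‖²) [0,−t₀) s ≤ 0` for every `s ∈ [0,−t₀)`.  On the interior the within-derivative is
the derivative (the shifted time is `< 0`, where `v` is jointly smooth), so `s ↦ ‖v(t₀+s,x)‖²` is continuous on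
`[0,−t₀)`, differentiable on `(0,−t₀)` with non-positive derivative, hence antitone (`antitoneOn_of_deriv_nonpos`);
read at `s = 0` and `s = t₁ − t₀`.

HONEST FRAMING: a pointwise dissipation statement about HYPOTHETICAL level-head Type-I profiles (stub of a DRAFT
door route's crux); nothing here bears on the door's Target, on 0056 `NoTypeII`, or on Navier–Stokes regularity.
-/

noncomputable section

set_option linter.dupNamespace false

namespace Summit.NavierStokesRegularity.NavierStokesRegularity.Theorems.LevelHeadProfileRigidity

open MeasureTheory Set Filter Topology Metric Function
open Literature.Analysis Literature.Analysis.FluidPDE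
open Summit.NavierStokesRegularity.NavierStokesRegularity.Theorems.LocalPressureProfileDoorPressureWindowToSlab
  (isClassicalNSSolutionOn_rieszPressure_of_class)

/-- **Stub `stub_headMonotone` of the registered skeleton of crux `LevelHeadProfileRigidity`**
(stmt-NavierStokesRegularity-28095; LINE g6-2, planner ns-idea-6 g6, sha12 `4684503e85f1`), signature VERBATIM
(`StubHeadMonotone`): zero Bernoulli head on every slice ⇒ pointwise non-increasing speed.  From the tree's
fixed-time head-max-point lemma (item 3036) on time-shifted strips. [folklore] -/
theorem headMonotone :
    ∀ (C D : ℝ) (v : ℝ → EuclideanSpace ℝ (Fin 3) → EuclideanSpace ℝ (Fin 3)), Literature.Analysis.FluidPDE.HasTypeITimeDecay C v → Literature.Analysis.FluidPDE.HasTypeIDecay D v → ContinuousOn (Function.uncurry v) (Set.Iio (0 : ℝ) ×ˢ Set.univ) → (∀ s t : ℝ, s < t → t < 0 → ∀ x, v t x = Literature.Analysis.UnboundedOperators.heatExtension (v s) (t - s) x - Literature.Analysis.FluidPDE.oseenDuhamel 1 s v v t x) → (∀ t < 0, Literature.Analysis.FluidPDE.VectorCalculus.IsDivFree (v t)) → (∀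 t < 0, ∀ z : EuclideanSpace ℝ (Fin 3), Literature.Analysis.FluidPDE.pressurePotential (v t) z + ‖v t z‖ ^ 2 / 2 = 0) → ∀ x : EuclideanSpace ℝ (Fin 3), ∀ t₀ t₁ : ℝ, t₀ < t₁ → t₁ < 0 → ‖v t₁ x‖ ≤ ‖v t₀ x‖ := by
  intro C D v _hrate hdec hcont hmild hdiv hhead x t₀ t₁ ht₀₁ ht₁
  have ht₀ : t₀ < 0 := ht₀₁.trans ht₁
  -- `(v, Q[v])` is classical on the open slab
  have hcl := isClassicalNSSolutionOn_rieszPressure_of_class hdec hcont hmild hdiv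
  -- the time shift by `t₀`, restricted to `[0, -t₀)`
  set T' : ℝ := -t₀ with hT'
  have hT'pos : 0 < T' := by simp only [hT']; linarith
  have hpre : Ico (0 : ℝ) T' ⊆ (fun s : ℝ => s + t₀) ⁻¹' Iio (0 : ℝ) := by
    intro s hs
    show s + t₀ < 0
    have := hs.2
    simp only [hT'] at this
    linarith
  have hclS : IsClassicalNSSolutionOn (Ico (0 : ℝ) T') 1 0 (fun s => v (s + t₀))
      (fun s x => pressurePotential (v (s + t₀)) x) :=
    (hcl.comp_add_right t₀).mono hpre (uniqueDiffOn_Ico 0 T')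
  -- the speed along the shifted strip at the point `x`
  set g : ℝ → ℝ := fun s => ‖v (s + t₀) x‖ ^ 2 with hg
  -- the head-max-point lemma: the within-derivative of `g` is non-positive on `[0, T')`
  have hwithin : ∀ s ∈ Ico (0 : ℝ) T', derivWithin g (Ico (0 : ℝ) T') s ≤ 0 := by
    intro s hs
    have hst : s + t₀ < 0 := hpre hs
    have hmax : IsLocalMax (fun y => ‖(fun s => v (s + t₀)) s y‖ ^ 2 / 2 +
        (fun s x => pressurePotential (v (s + t₀)) x) s y) x := by
      have hzero : ∀ y, ‖(fun s => v (s + t₀)) s y‖ ^ 2 / 2 +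
          (fun s x => pressurePotential (v (s + t₀)) x) s y = 0 := by
        intro y
        have := hhead (s + t₀) hst y
        show ‖v (s + t₀) y‖ ^ 2 / 2 + pressurePotential (v (s + t₀)) y = 0
        linarith
      refine Filter.Eventually.of_forall fun y => ?_
      exact le_of_eq ((hzero y).trans (hzero x).symm)
    have key := Summit.NavierStokesRegularity.NavierStokesRegularity.Theorems.bernoulliDeceleration_headMaxPointLemma_proof
      1 T' zero_le_one (fun s => v (s + t₀)) (fun s x => pressurePotential (v (s + t₀)) x) hclS s hs x hmax
    rw [timeDerivWithin_apply] at key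
    have hnn : 0 ≤ 2 * (1 : ℝ) * ‖curl ((fun s => v (s + t₀)) s) x‖ ^ 2 := by positivity
    have : derivWithin (fun s => ‖(fun s => v (s + t₀)) s x‖ ^ 2) (Ico (0 : ℝ) T') s ≤ 0 := by linarith
    simpa [hg] using this
  -- `g` is continuous on `[0, T')`
  have hgcont : ContinuousOn g (Ico (0 : ℝ) T') := by
    have h1 : ContinuousOn (fun s : ℝ => uncurry (fun s => v (s + t₀)) (s, x)) (Ico (0 : ℝ) T') :=
      hclS.smooth_velocity.continuousOn.comp (continuousOn_id.prodMk continuousOn_const)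
        fun s hs => mk_mem_prod hs (mem_univ x)
    exact (h1.norm.pow 2).congr fun s _ => rfl
  -- `g` is differentiable on the interior, where the within-derivative is the derivative
  have hdiffAt : ∀ s ∈ Ioo (0 : ℝ) T', DifferentiableAt ℝ g s := by
    intro s hs
    have hst : s + t₀ < 0 := hpre (Ioo_subset_Ico_self hs)
    have hV : ContDiffAt ℝ (⊤ : ℕ∞) (uncurry v) (s + t₀, x) :=
      hcl.smooth_velocity.contDiffAt isOpen_Iio hst x
    have hφ : DifferentiableAt ℝ (fun σ : ℝ => (σ + t₀, x)) s :=
      ((differentiableAt_id.add_const t₀).prodMk (differentiableAt_const x))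
    have hcomp : DifferentiableAt ℝ (fun σ : ℝ => uncurry v (σ + t₀, x)) s := by
      have h := (hV.differentiableAt (by simp)).comp s hφ
      simpa [Function.comp_def] using h
    have h2 : DifferentiableAt ℝ (fun σ : ℝ => ‖uncurry v (σ + t₀, x)‖ ^ 2) s := hcomp.norm_sq ℝ
    exact h2.congr_of_eventuallyEq (Filter.Eventually.of_forall fun σ => rfl)
  have hgdiff : DifferentiableOn ℝ g (interior (Ico (0 : ℝ) T')) := by
    rw [interior_Ico]
    exact fun s hs => (hdiffAt s hs).differentiableWithinAt
  have hderiv : ∀ s ∈ interior (Ico (0 : ℝ) T'), deriv g s ≤ 0 := by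
    rw [interior_Ico]
    intro s hs
    have hmem : Ico (0 : ℝ) T' ∈ 𝓝 s := mem_of_superset (Ioo_mem_nhds hs.1 hs.2) Ioo_subset_Ico_self
    rw [← derivWithin_of_mem_nhds hmem]
    exact hwithin s (Ioo_subset_Ico_self hs)
  have hanti : AntitoneOn g (Ico (0 : ℝ) T') := antitoneOn_of_deriv_nonpos (convex_Ico 0 T') hgcont hgdiff hderiv
  -- read at `s = 0` and `s = t₁ - t₀`
  have h0 : (0 : ℝ) ∈ Ico (0 : ℝ) T' := ⟨le_rfl, hT'pos⟩
  have h1 : t₁ - t₀ ∈ Ico (0 : ℝ) T' := ⟨by linarith, by simp only [hT']; linarith⟩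
  have hle := hanti h0 h1 (by linarith : (0 : ℝ) ≤ t₁ - t₀)
  have e0 : g 0 = ‖v t₀ x‖ ^ 2 := by simp [hg]
  have e1 : g (t₁ - t₀) = ‖v t₁ x‖ ^ 2 := by simp [hg]
  rw [e0, e1] at hle
  exact (pow_le_pow_iff_left₀ (norm_nonneg _) (norm_nonneg _) two_ne_zero).1 hle

/-- Alias under the skeleton's stub name. [folklore] -/
theorem stub_headMonotone :
    ∀ (C D : ℝ) (v : ℝ → EuclideanSpace ℝ (Fin 3) → EuclideanSpace ℝ (Fin 3)), Literature.Analysis.FluidPDE.HasTypeITimeDecay C v → Literature.Analysis.FluidPDE.HasTypeIDecay D v → ContinuousOn (Function.uncurry v) (Set.Iio (0 : ℝ) ×ˢ Set.univ) → (∀ s t : ℝ, s < t → t < 0 → ∀ x, v t x = Literature.Analysis.UnboundedOperators.heatExtension (v s) (t - s) x - Literature.Analysis.FluidPDE.oseenDuhamel 1 s v v t x) → (∀ t < 0, Literature.Analysis.FluidPDE.VectorCalculus.IsDivFree (v t)) → (∀ t < 0, ∀ z : EuclideanSpace ℝ (Fin 3), Literature.Analysis.FluidPDE.pressurePotential (v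 t) z + ‖v t z‖ ^ 2 / 2 = 0) → ∀ x : EuclideanSpace ℝ (Fin 3), ∀ t₀ t₁ : ℝ, t₀ < t₁ → t₁ < 0 → ‖v t₁ x‖ ≤ ‖v t₀ x‖ :=
  headMonotone

end Summit.NavierStokesRegularity.NavierStokesRegularity.Theorems.LevelHeadProfileRigidity

end
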